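import Summits.QuantumFields.QCD.Theses.SpectralDefectExtinction
import Literature.MathematicalPhysics.QuantumLattice.OverlapLocality
import Literature.MathematicalPhysics.QuantumFieldTheory.SpectralDefectDensity
import Summits.QuantumFields.QCD.Theorems.TipPricing.Negative.TightPins
import Summits.QuantumFields.QCD.Theorems.SpectralDefectExtinctionTipNoBindingStubPositivity
import Summits.QuantumFields.QCD.Theorems.WindowExtinction.Negative.SpectralFlowLocal
import Summits.QuantumFields.QCD.Theorems.SpectralDefectExtinctionTipPricingStubImsColdBoxesAux

/-!
# Stub `stub_imsColdBoxes` of line `covariant-laplacian-floor` (deep part of the heavy-side DOS bound of line `hermitian-flow-coarea`)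
(crux `Summit.QuantumFields.QCD.Theses.SpectralDefectExtinction.TipPricing`, item stmt-QuantumFields-8967)

**What is proved** (`stub_imsColdBoxes`, with the explicit constant `C₀ = 24`).  On the torus `(ℤ/(2S+1))⁴`,
for every `SU(3)` link field `U`, every radius `1 ≤ R` with `R + 1 ≤ S`, every level `E ≥ 0` and every
`η ∈ (0,1)`:

  `(1 − η) · #{eigenvalues of Lap_U below E} ≤ 3 · #{c ∈ {−S,…,S}⁴ : the box torusBox c R is E'-cold}`,

`E' = (E + 24/R²)/η`, where `Lap_U = Σ_μ (2 − F_μ − F_μᴴ)` is the covariant Laplacian on site ⊗ colour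
(`F_μ = linkHop`, the `U`-twisted forward shift) and a box is `E'`-cold iff some non-zero colour field
supported in it has `Re⟨v, Lap_U v⟩ ≤ E'‖v‖²`.

**Proof** (lattice IMS localisation + a trace count; the error is `U`-free).
1. *Twisted shift and weights* (`ims_linkHop_mulVec_weight`): for a real site weight `w`,
   `F_μ(w v) = w(· + μ̂) F_μ v`, hence `⟨wv, F_μ(wv)⟩ = Σ_x w(x)w(x+μ̂) (v̄ F_μ v)(x)`.
2. *IMS identities* (`ims_sum_form_linkHop`, `ims_sum_form_one`, `ims_sum_re_form_lap`): for the translates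
   `ω_a = ω(· − a)` of ONE weight over ALL centres `a` of the torus, translation invariance gives
   `Σ_a ⟨ω_a v, F_μ ω_a v⟩ = P_μ ⟨v, F_μ v⟩`, `Σ_a ‖ω_a v‖² = M ‖v‖²` (`M = Σ ω²`, `P_μ = Σ ω ω(·+μ̂)`), so
   `Σ_a Re⟨ω_a v, Lap_U ω_a v⟩ = M Re⟨v, Lap_U v⟩ + Σ_μ 2(M − P_μ) Re⟨v, F_μ v⟩ ≤ M Re⟨v, Lap_U v⟩ + 8δM‖v‖²`
   when `0 ≤ M − P_μ ≤ δM` (`|Re⟨v, F_μ v⟩| ≤ ‖v‖²`, `F_μ` an isometry: `conjTranspose_mul_linkHop`).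
3. *Partition of unity* (`stub_imsPartition`, helper file `…StubImsColdBoxesAux`): the product tent of
   radius `R` has `M > 0`, `δ = 3/R²` (so `8δ = 24/R² = C₀/R²`) and is supported in the projected box, so
   `ω_a v` is supported in `torusBox (lift a) R`, `lift a` the `valMinAbs`-representative of `a`.
4. *Mass on cold boxes* (`ims_bad_mass`): if `Re⟨v, Lap_U v⟩ ≤ E‖v‖²`, the non-cold centres are
   `E'`-coercive on `ω_a v` and `Lap_U ⪰ 0` on the cold ones, so `E' Σ_good ‖ω_a v‖² ≤ (E + 24/R²) M‖v‖²
   = ηE'M‖v‖²`, i.e. `Σ_bad ‖ω_a v‖² ≥ (1 − η) M‖v‖²`; the left side is the diagonal form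
   `Σ_i B(i)|v_i|²`, `B(i) = Σ_{bad a} ω(i.1 − a)²` (`ims_bad_mass_eq`).
5. *Trace count* (`ims_count`, helper file): applied to the orthonormal eigenvectors of the Hermitian
   `Lap_U` below `E`, `(1 − η) M · #{λ < E} ≤ Σ_i B(i) = 3 M · #bad` (colour factor `3`,
   `Σ_x ω(x − a)² = M`); divide by `M > 0` and inject the bad torus centres into `box 4 S` by `valMinAbs`
   (`torusBox (lift a) R` is literally the box of the statement).
The eigenvalue count is Mathlib's `IsHermitian.eigenvalues` through `countP_roots_eq_card_filter`.

Sources: the IMS localisation formula — H. Cycon, R. Froese, W. Kirsch, B. Simon, *Schrödinger Operators*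
(Springer 1987), Thm. 3.2, here in its lattice form (nearest-neighbour hopping, error quadratic in the gradient
of the cut-off); its use for counting low levels by boxes (Lifshitz tails) — W. Kirsch, B. Metzger, *The
integrated density of states for random Schrödinger operators*, Proc. Sympos. Pure Math. 76 (2007)
(arXiv:math-ph/0608066); trace/variational counting — Reed–Simon IV, Thm. XIII.1–XIII.2.
Tree facts used (all proved): `linkHop`, `conjTranspose_mul_linkHop`, `fundamentalRep_mem_unitaryGroup`,
`torusBox`, `box`, `Torus.proj`, `countP_roots_eq_card_filter`, `re_star_dotProduct_self`,
`star_dotProduct_self_eq`, `norm_star_dotProduct_le_of_sq_le`, and Mathlib.  No named facts.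
-/

namespace Summit.QuantumFields.QCD.Cruxes.TipPricing.CovariantLaplacianFloor

open MeasureTheory Filter Matrix
open Literature.MathematicalPhysics.QuantumLattice Literature.MathematicalPhysics.QuantumFieldTheory
  Literature.Probability.LatticeModels
open Summit.QuantumFields.QCD.Theses.SpectralDefectExtinction
open scoped Classical

noncomputable section

/-! ## The twisted shift and the IMS identities -/

section IMS

variable {L : ℕ} [NeZero L] (U : GaugeConfig 4 L SU3)

/-- Entrywise action of the twisted shift: `(F_μ u)(x,a) = Σ_b U(x,μ)_{ab} u(x+μ̂, b)`. -/
theorem ims_linkHop_mulVec (μ : Fin 4) (u : TorusSite 4 L × Fin 3 → ℂ) (p : TorusSite 4 L × Fin 3) :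
    (linkHop (fundamentalRep (Fin 3)) U μ *ᵥ u) p = ∑ b : Fin 3, (fundamentalRep (Fin 3) (U (p.1, μ))) p.2 b *
      u (Literature.MathematicalPhysics.QuantumFieldTheory.Site.shift p.1 μ, b) := by
  rw [mulVec, dotProduct, Fintype.sum_prod_type]
  simp only [linkHop, Matrix.of_apply, ite_mul, zero_mul]
  rw [Finset.sum_comm]
  simp

/-- The twisted shift on a weighted field: `F_μ (w v) = w(· + μ̂) · F_μ v` for a real site weight `w`. -/
theorem ims_linkHop_mulVec_weight (μ : Fin 4) (w : TorusSite 4 L → ℝ) (v : TorusSite 4 L × Fin 3 → ℂ)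
    (p : TorusSite 4 L × Fin 3) :
    (linkHop (fundamentalRep (Fin 3)) U μ *ᵥ fun q => ((w q.1 : ℝ) : ℂ) * v q) p =
      ((w (p.1 + Pi.single μ 1) : ℝ) : ℂ) * (linkHop (fundamentalRep (Fin 3)) U μ *ᵥ v) p := by
  rw [ims_linkHop_mulVec, ims_linkHop_mulVec, Finset.mul_sum,
    Literature.MathematicalPhysics.QuantumFieldTheory.Site.shift]
  exact Finset.sum_congr rfl fun b _ => by ring

/-- IMS for the hopping term: `Σ_a ⟨ω_a v, F_μ (ω_a v)⟩ = (Σ_y ω(y)ω(y+μ̂)) ⟨v, F_μ v⟩`, `ω_a = ω(· − a)`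
(translation invariance of the sum over all centres `a` of the torus). -/
theorem ims_sum_form_linkHop (μ : Fin 4) (ω : TorusSite 4 L → ℝ) (v : TorusSite 4 L × Fin 3 → ℂ) :
    ∑ a : TorusSite 4 L, star (fun q : TorusSite 4 L × Fin 3 => ((ω (q.1 - a) : ℝ) : ℂ) * v q) ⬝ᵥ
        (linkHop (fundamentalRep (Fin 3)) U μ *ᵥ fun q => ((ω (q.1 - a) : ℝ) : ℂ) * v q) =
      ((∑ y, ω y * ω (y + Pi.single μ 1) : ℝ) : ℂ) * (star v ⬝ᵥ linkHop (fundamentalRep (Fin 3)) U μ *ᵥ v) := by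
  have hkey : ∀ a : TorusSite 4 L,
      star (fun q : TorusSite 4 L × Fin 3 => ((ω (q.1 - a) : ℝ) : ℂ) * v q) ⬝ᵥ
        (linkHop (fundamentalRep (Fin 3)) U μ *ᵥ fun q => ((ω (q.1 - a) : ℝ) : ℂ) * v q) =
      ∑ p, ((ω (p.1 - a) * ω (p.1 - a + Pi.single μ 1) : ℝ) : ℂ) *
        (star (v p) * (linkHop (fundamentalRep (Fin 3)) U μ *ᵥ v) p) := by
    intro a
    rw [dotProduct]
    refine Finset.sum_congr rfl fun p _ => ?_
    rw [ims_linkHop_mulVec_weight U μ (fun x => ω (x - a)) v p, Pi.star_apply, star_mul,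
      Complex.star_def, Complex.conj_ofReal, show p.1 + Pi.single μ 1 - a = p.1 - a + Pi.single μ 1 by abel]
    push_cast
    ring
  simp_rw [hkey]
  rw [Finset.sum_comm, dotProduct, Finset.mul_sum]
  refine Finset.sum_congr rfl fun p _ => ?_
  rw [← Finset.sum_mul, ← Complex.ofReal_sum]
  congr 2
  exact Fintype.sum_equiv (Equiv.subLeft p.1) _ _ fun a => rfl

/-- IMS for the mass term: `Σ_a ⟨ω_a v, ω_a v⟩ = (Σ_y ω(y)²) ⟨v, v⟩`. -/
theorem ims_sum_form_one (ω : TorusSite 4 L → ℝ) (v : TorusSite 4 L × Fin 3 → ℂ) :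
    ∑ a : TorusSite 4 L, star (fun q : TorusSite 4 L × Fin 3 => ((ω (q.1 - a) : ℝ) : ℂ) * v q) ⬝ᵥ
        (fun q : TorusSite 4 L × Fin 3 => ((ω (q.1 - a) : ℝ) : ℂ) * v q) =
      ((∑ y, ω y ^ 2 : ℝ) : ℂ) * (star v ⬝ᵥ v) := by
  have hkey : ∀ a : TorusSite 4 L,
      star (fun q : TorusSite 4 L × Fin 3 => ((ω (q.1 - a) : ℝ) : ℂ) * v q) ⬝ᵥ
        (fun q : TorusSite 4 L × Fin 3 => ((ω (q.1 - a) : ℝ) : ℂ) * v q) =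
      ∑ p, ((ω (p.1 - a) ^ 2 : ℝ) : ℂ) * (star (v p) * v p) := by
    intro a
    rw [dotProduct]
    refine Finset.sum_congr rfl fun p _ => ?_
    rw [Pi.star_apply, star_mul, Complex.star_def, Complex.conj_ofReal]
    push_cast
    ring
  simp_rw [hkey]
  rw [Finset.sum_comm, dotProduct, Finset.mul_sum]
  refine Finset.sum_congr rfl fun p _ => ?_
  rw [← Finset.sum_mul, ← Complex.ofReal_sum]
  congr 2
  exact Fintype.sum_equiv (Equiv.subLeft p.1) _ _ fun a => rfl

/-- The mass of the bad translates is a diagonal form: `Σ_{a ∈ Bad} ‖ω_a v‖² = Σ_i B(i) |v i|²` with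
`B(i) = Σ_{a ∈ Bad} ω(i.1 − a)²`. -/
theorem ims_bad_mass_eq (ω : TorusSite 4 L → ℝ) (Bad : Finset (TorusSite 4 L)) (v : TorusSite 4 L × Fin 3 → ℂ) :
    ∑ a ∈ Bad, ∑ i, ‖(fun q : TorusSite 4 L × Fin 3 => ((ω (q.1 - a) : ℝ) : ℂ) * v q) i‖ ^ 2 =
      ∑ i, (∑ a ∈ Bad, ω (i.1 - a) ^ 2) * ‖v i‖ ^ 2 := by
  rw [Finset.sum_comm]
  refine Finset.sum_congr rfl fun i _ => ?_
  rw [Finset.sum_mul]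
  refine Finset.sum_congr rfl fun a _ => ?_
  rw [norm_mul, Complex.norm_real, Real.norm_eq_abs, mul_pow, sq_abs]

/-! ## The covariant Laplacian `A = Lap_U = Σ_μ (2 − F_μ − F_μᴴ)` -/

variable {A : Matrix (TorusSite 4 L × Fin 3) (TorusSite 4 L × Fin 3) ℂ}
  (hA : A = ∑ μ : Fin 4, ((2 : ℂ) • (1 : Matrix (TorusSite 4 L × Fin 3) (TorusSite 4 L × Fin 3) ℂ)
    - linkHop (fundamentalRep (Fin 3)) U μ - (linkHop (fundamentalRep (Fin 3)) U μ)ᴴ))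

include hA

/-- The quadratic form of `Lap_U`, expanded: `⟨u, Lap u⟩ = Σ_μ (2⟨u,u⟩ − ⟨u, F_μ u⟩ − conj ⟨u, F_μ u⟩)`. -/
theorem ims_form_lap (u : TorusSite 4 L × Fin 3 → ℂ) :
    star u ⬝ᵥ A *ᵥ u = ∑ μ : Fin 4, (2 * (star u ⬝ᵥ u) - star u ⬝ᵥ linkHop (fundamentalRep (Fin 3)) U μ *ᵥ u
        - star (star u ⬝ᵥ linkHop (fundamentalRep (Fin 3)) U μ *ᵥ u)) := by
  rw [hA, Matrix.sum_mulVec, dotProduct_sum]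
  refine Finset.sum_congr rfl fun μ _ => ?_
  rw [sub_mulVec, sub_mulVec, Matrix.smul_mulVec, one_mulVec, dotProduct_sub, dotProduct_sub,
    dotProduct_smul, smul_eq_mul, ims_form_conjTranspose]

/-- Real part of the Laplacian form: `Re⟨u, Lap u⟩ = Σ_μ (2‖u‖² − 2 Re⟨u, F_μ u⟩)`. -/
theorem ims_re_form_lap (u : TorusSite 4 L × Fin 3 → ℂ) :
    (star u ⬝ᵥ A *ᵥ u).re =
      ∑ μ : Fin 4, (2 * ∑ i, ‖u i‖ ^ 2 - 2 * (star u ⬝ᵥ linkHop (fundamentalRep (Fin 3)) U μ *ᵥ u).re) := by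
  rw [ims_form_lap U hA, Complex.re_sum]
  refine Finset.sum_congr rfl fun μ _ => ?_
  have h2 : ((2 : ℂ) * (star u ⬝ᵥ u)).re = 2 * ∑ i, ‖u i‖ ^ 2 := by
    rw [Theorems.TiltedFlatnessNegative.star_dotProduct_self_eq, ← Complex.ofReal_ofNat, ← Complex.ofReal_mul, Complex.ofReal_re]
  rw [Complex.sub_re, Complex.sub_re, Complex.star_def, Complex.conj_re, h2]
  ring

/-- Wilson positivity of the covariant Laplacian: `0 ≤ Re⟨u, Lap_U u⟩` (each `F_μ` is an isometry). -/
theorem ims_re_form_lap_nonneg (u : TorusSite 4 L × Fin 3 → ℂ) : 0 ≤ (star u ⬝ᵥ A *ᵥ u).re := by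
  rw [ims_re_form_lap U hA]
  refine Finset.sum_nonneg fun μ _ => ?_
  have := ims_re_form_le_of_isometry
    (conjTranspose_mul_linkHop (fundamentalRep (Fin 3)) fundamentalRep_mem_unitaryGroup U μ) u
  linarith

/-- **The lattice IMS localisation formula with its error.**  For every real weight `ω` on the torus and
every `v`: `Σ_a Re⟨ω_a v, Lap_U (ω_a v)⟩ = (Σ ω²) Re⟨v, Lap_U v⟩ + Σ_μ 2 (Σ ω² − Σ ω ω(·+μ̂)) Re⟨v, F_μ v⟩`. -/
theorem ims_sum_re_form_lap (ω : TorusSite 4 L → ℝ) (v : TorusSite 4 L × Fin 3 → ℂ) :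
    ∑ a : TorusSite 4 L, (star (fun q : TorusSite 4 L × Fin 3 => ((ω (q.1 - a) : ℝ) : ℂ) * v q) ⬝ᵥ
        A *ᵥ fun q : TorusSite 4 L × Fin 3 => ((ω (q.1 - a) : ℝ) : ℂ) * v q).re =
      (∑ y, ω y ^ 2) * (star v ⬝ᵥ A *ᵥ v).re + ∑ μ : Fin 4, 2 * (∑ y, ω y ^ 2 - ∑ y, ω y * ω (y + Pi.single μ 1)) *
        (star v ⬝ᵥ linkHop (fundamentalRep (Fin 3)) U μ *ᵥ v).re := by
  simp_rw [ims_re_form_lap U hA]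
  rw [Finset.sum_comm, Finset.mul_sum, ← Finset.sum_add_distrib]
  refine Finset.sum_congr rfl fun μ _ => ?_
  have h1 := congrArg Complex.re (ims_sum_form_one (L := L) ω v)
  have h2 := congrArg Complex.re (ims_sum_form_linkHop U μ ω v)
  rw [Complex.re_sum] at h1 h2
  rw [Complex.re_ofReal_mul, Theorems.ExtinctionBuildsQCD.Negative.re_star_dotProduct_self] at h1
  rw [Complex.re_ofReal_mul] at h2
  simp_rw [Theorems.ExtinctionBuildsQCD.Negative.re_star_dotProduct_self] at h1
  rw [Finset.sum_sub_distrib, ← Finset.mul_sum, ← Finset.mul_sum, h1, h2]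
  ring

/-! ## From the IMS error to the mass on cold boxes -/

/-- **Mass on the bad centres.**  If `Re⟨v, Lap v⟩ ≤ E‖v‖²`, the IMS error of `ω` is `≤ δ Σω²` in each
direction, and every centre outside `Bad` is `(E + 8δ)/η`-coercive on `ω_a v`, then the translates over `Bad`
carry at least the fraction `1 − η` of the total mass `(Σ ω²)‖v‖²` of all translates. -/
theorem ims_bad_mass (ω : TorusSite 4 L → ℝ) {δ E η : ℝ} (hE : 0 ≤ E) (hη : 0 < η) (hδ : 0 < δ)
    (hgap : ∀ μ : Fin 4, 0 ≤ ∑ x, ω x ^ 2 - ∑ x, ω x * ω (x + Pi.single μ 1) ∧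
        ∑ x, ω x ^ 2 - ∑ x, ω x * ω (x + Pi.single μ 1) ≤ δ * ∑ x, ω x ^ 2)
    (Bad : Finset (TorusSite 4 L)) (v : TorusSite 4 L × Fin 3 → ℂ)
    (hv : (star v ⬝ᵥ A *ᵥ v).re ≤ E * ∑ i, ‖v i‖ ^ 2)
    (hgood : ∀ a ∉ Bad, (E + 8 * δ) / η *
        ∑ i, ‖(fun q : TorusSite 4 L × Fin 3 => ((ω (q.1 - a) : ℝ) : ℂ) * v q) i‖ ^ 2 ≤
      (star (fun q : TorusSite 4 L × Fin 3 => ((ω (q.1 - a) : ℝ) : ℂ) * v q) ⬝ᵥ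
        A *ᵥ fun q : TorusSite 4 L × Fin 3 => ((ω (q.1 - a) : ℝ) : ℂ) * v q).re) :
    (1 - η) * (∑ x, ω x ^ 2) * ∑ i, ‖v i‖ ^ 2 ≤
      ∑ a ∈ Bad, ∑ i, ‖(fun q : TorusSite 4 L × Fin 3 => ((ω (q.1 - a) : ℝ) : ℂ) * v q) i‖ ^ 2 := by
  set M2 : ℝ := ∑ x, ω x ^ 2 with hM2
  have hM20 : 0 ≤ M2 := Finset.sum_nonneg fun x _ => sq_nonneg _
  set nv : ℝ := ∑ i, ‖v i‖ ^ 2 with hnv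
  have hnv0 : 0 ≤ nv := Finset.sum_nonneg fun i _ => sq_nonneg _
  -- the localised energies `q a = Re⟨ω_a v, Lap ω_a v⟩` and masses `m a = ‖ω_a v‖²`
  set q : TorusSite 4 L → ℝ := fun a => (star (fun q : TorusSite 4 L × Fin 3 => ((ω (q.1 - a) : ℝ) : ℂ) * v q) ⬝ᵥ
    A *ᵥ fun q : TorusSite 4 L × Fin 3 => ((ω (q.1 - a) : ℝ) : ℂ) * v q).re with hq
  set m : TorusSite 4 L → ℝ := fun a =>
    ∑ i, ‖(fun q : TorusSite 4 L × Fin 3 => ((ω (q.1 - a) : ℝ) : ℂ) * v q) i‖ ^ 2 with hm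
  have hG : ∀ μ : Fin 4, (star v ⬝ᵥ linkHop (fundamentalRep (Fin 3)) U μ *ᵥ v).re ≤ nv := fun μ =>
    ims_re_form_le_of_isometry (conjTranspose_mul_linkHop (fundamentalRep (Fin 3)) fundamentalRep_mem_unitaryGroup U μ) v
  -- the IMS bound on the total localised energy
  have htot : ∑ a, q a ≤ (E + 8 * δ) * M2 * nv := by
    simp only [hq]
    rw [ims_sum_re_form_lap U hA ω v]
    have h1 := mul_le_mul_of_nonneg_left hv hM20
    have h2 : ∑ μ : Fin 4, 2 * (M2 - ∑ y, ω y * ω (y + Pi.single μ 1)) *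
        (star v ⬝ᵥ linkHop (fundamentalRep (Fin 3)) U μ *ᵥ v).re ≤ ∑ μ : Fin 4, 2 * (δ * M2) * nv := by
      refine Finset.sum_le_sum fun μ _ => ?_
      obtain ⟨h0, hle⟩ := hgap μ
      calc 2 * (M2 - ∑ y, ω y * ω (y + Pi.single μ 1)) * (star v ⬝ᵥ linkHop (fundamentalRep (Fin 3)) U μ *ᵥ v).re
          ≤ 2 * (M2 - ∑ y, ω y * ω (y + Pi.single μ 1)) * nv := mul_le_mul_of_nonneg_left (hG μ) (by linarith)
        _ ≤ 2 * (δ * M2) * nv := mul_le_mul_of_nonneg_right (by linarith) hnv0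
    have h3 : ∑ μ : Fin 4, 2 * (δ * M2) * nv = 8 * δ * M2 * nv := by
      rw [Finset.sum_const, Finset.card_univ, Fintype.card_fin, nsmul_eq_mul]
      push_cast
      ring
    nlinarith
  -- good centres are coercive, bad centres are non-negative
  have hsplit := Finset.sum_add_sum_compl Bad q
  have hbad0 : 0 ≤ ∑ a ∈ Bad, q a := Finset.sum_nonneg fun a _ => ims_re_form_lap_nonneg U hA _
  have hE' : 0 < (E + 8 * δ) / η := by positivity
  have hgood_mass : ∑ a ∈ Badᶜ, m a ≤ η * M2 * nv := by
    refine le_of_mul_le_mul_left ?_ hE'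
    rw [Finset.mul_sum]
    calc ∑ a ∈ Badᶜ, (E + 8 * δ) / η * m a ≤ ∑ a ∈ Badᶜ, q a :=
          Finset.sum_le_sum fun a ha => hgood a (Finset.mem_compl.mp ha)
      _ ≤ (E + 8 * δ) * M2 * nv := by linarith
      _ = (E + 8 * δ) / η * (η * M2 * nv) := by field_simp
  -- the total mass of the translates
  have hmass : ∑ a, m a = M2 * nv := by
    have h := congrArg Complex.re (ims_sum_form_one (L := L) ω v)
    rw [Complex.re_sum, Complex.re_ofReal_mul, Theorems.ExtinctionBuildsQCD.Negative.re_star_dotProduct_self] at h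
    simp_rw [Theorems.ExtinctionBuildsQCD.Negative.re_star_dotProduct_self] at h
    exact h
  have hsplit2 := Finset.sum_add_sum_compl Bad m
  rw [hmass] at hsplit2
  show (1 - η) * M2 * nv ≤ ∑ a ∈ Bad, m a
  nlinarith

end IMS

/-! ## Assembly -/

/-- **IMS cold-box count** (every mass split `η`).  There is a universal `C₀ > 0` (here `C₀ = 24`: eight
times the lattice IMS constant `3/R² · R²` of the product tent of radius `R`) such that on every torus of odd
side `2S+1`, for every field `U`, every box radius `1 ≤ R < S`, every level `E ≥ 0` and every `η ∈ (0,1)`: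
`(1 − η) · #{eigenvalues of Lap_U below E} ≤ 3 · #{centres c ∈ {−S..S}⁴ whose box torusBox c R is
((E + C₀/R²)/η)-COLD}`, where a box `B` is `E'`-cold for `U` iff some non-zero colour vector field
supported in `B` has covariant Dirichlet energy `Re⟨v, Lap_U v⟩ ≤ E' ‖v‖²`.  Proof: module docstring
(IMS partition of unity over all torus translates, coercivity of the good boxes, trace count on the
spectral subspace, `valMinAbs` lift of the bad centres into `box 4 S`). -/
theorem stub_imsColdBoxes :
    ∃ C₀ : ℝ, 0 < C₀ ∧ ∀ (S : ℕ) (U : GaugeConfig 4 (2 * S + 1) SU3) (R : ℕ) (E η : ℝ),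
      1 ≤ R → R + 1 ≤ S → 0 ≤ E → 0 < η → η < 1 →
      (1 - η) * (Multiset.countP (fun z : ℂ => z.re < E)
          (∑ μ : Fin 4, ((2 : ℂ) • (1 : Matrix (TorusSite 4 (2 * S + 1) × Fin 3)
              (TorusSite 4 (2 * S + 1) × Fin 3) ℂ)
            - linkHop (fundamentalRep (Fin 3)) U μ
            - (linkHop (fundamentalRep (Fin 3)) U μ)ᴴ)).charpoly.roots : ℝ)
        ≤ 3 * (((box 4 S).filter fun c : Site 4 =>
            ∃ v : TorusSite 4 (2 * S + 1) × Fin 3 → ℂ, v ≠ 0 ∧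
              (∀ p : TorusSite 4 (2 * S + 1) × Fin 3, p.1 ∉ torusBox (2 * S + 1) c R → v p = 0) ∧
              (star v ⬝ᵥ (∑ μ : Fin 4, ((2 : ℂ) • (1 : Matrix (TorusSite 4 (2 * S + 1) × Fin 3)
                  (TorusSite 4 (2 * S + 1) × Fin 3) ℂ)
                - linkHop (fundamentalRep (Fin 3)) U μ
                - (linkHop (fundamentalRep (Fin 3)) U μ)ᴴ)) *ᵥ v).re
                ≤ (E + C₀ / (R : ℝ) ^ 2) / η * ∑ i, ‖v i‖ ^ 2).card : ℝ) := by
  refine ⟨24, by norm_num, ?_⟩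
  intro S U R E η hR hRS hE hη hη1
  -- the Laplacian and its Hermitian structure
  set A : Matrix (TorusSite 4 (2 * S + 1) × Fin 3) (TorusSite 4 (2 * S + 1) × Fin 3) ℂ :=
    ∑ μ : Fin 4, ((2 : ℂ) • (1 : Matrix (TorusSite 4 (2 * S + 1) × Fin 3)
      (TorusSite 4 (2 * S + 1) × Fin 3) ℂ) - linkHop (fundamentalRep (Fin 3)) U μ
      - (linkHop (fundamentalRep (Fin 3)) U μ)ᴴ) with hAdef
  have hA : A.IsHermitian := by
    rw [hAdef, Matrix.IsHermitian, Matrix.conjTranspose_sum]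
    refine Finset.sum_congr rfl fun μ _ => ?_
    rw [conjTranspose_sub, conjTranspose_sub, conjTranspose_smul, conjTranspose_one,
      conjTranspose_conjTranspose, sub_right_comm]
    congr 2
    simp
  -- the IMS partition of unity
  obtain ⟨ω, hM2pos, hgap, hsupp⟩ := stub_imsPartition S R hR hRS
  set M2 : ℝ := ∑ x, ω x ^ 2 with hM2
  have hR0 : (0 : ℝ) < R := by exact_mod_cast hR
  have h24 : (E + 8 * (3 / (R : ℝ) ^ 2)) / η = (E + 24 / (R : ℝ) ^ 2) / η := by ring
  -- lifting torus centres to lattice centres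
  set lift : TorusSite 4 (2 * S + 1) → Site 4 := fun a i => (a i).valMinAbs with hlift
  have hproj_lift : ∀ a, Torus.proj (2 * S + 1) (lift a) = a := fun a => by
    funext i; simp [hlift, Torus.proj_apply, ZMod.coe_valMinAbs]
  -- the cold predicate of the statement
  set cold : Site 4 → Prop := fun c => ∃ v : TorusSite 4 (2 * S + 1) × Fin 3 → ℂ, v ≠ 0 ∧
      (∀ p : TorusSite 4 (2 * S + 1) × Fin 3, p.1 ∉ torusBox (2 * S + 1) c R → v p = 0) ∧
      (star v ⬝ᵥ A *ᵥ v).re ≤ (E + 24 / (R : ℝ) ^ 2) / η * ∑ i, ‖v i‖ ^ 2 with hcold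
  set Bad : Finset (TorusSite 4 (2 * S + 1)) := Finset.univ.filter fun a => cold (lift a) with hBad
  rw [Theorems.WindowExtinction.Negative.countP_roots_eq_card_filter hA (· < E)]
  -- every low-energy vector leaves the fraction `1 - η` of its weighted mass on bad translates
  have hvec : ∀ v : TorusSite 4 (2 * S + 1) × Fin 3 → ℂ,
      (star v ⬝ᵥ A *ᵥ v).re ≤ E * ∑ i, ‖v i‖ ^ 2 →
      (1 - η) * M2 * ∑ i, ‖v i‖ ^ 2 ≤ ∑ i, (∑ a ∈ Bad, ω (i.1 - a) ^ 2) * ‖v i‖ ^ 2 := by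
    intro v hv
    rw [← ims_bad_mass_eq]
    refine ims_bad_mass U hAdef ω hE hη (by positivity : (0 : ℝ) < 3 / (R : ℝ) ^ 2) hgap Bad v hv
      fun a ha => ?_
    rw [h24]
    by_cases hu : (fun q : TorusSite 4 (2 * S + 1) × Fin 3 => ((ω (q.1 - a) : ℝ) : ℂ) * v q) = 0
    · rw [hu]
      simp
    · have hna : ¬ cold (lift a) := by
        simpa [hBad] using ha
      simp only [hcold, not_exists, not_and, not_le] at hna
      refine (hna _ hu fun p hp => ?_).le
      by_contra hne
      have hω : ω (p.1 - a) ≠ 0 := by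
        intro h0
        apply hne
        simp only [h0, Complex.ofReal_zero, zero_mul]
      obtain ⟨y, hy, hyx⟩ := hsupp (p.1 - a) hω
      apply hp
      rw [torusBox, Finset.mem_image]
      refine ⟨y, hy, ?_⟩
      have hadd : Torus.proj (2 * S + 1) (lift a + y) =
          Torus.proj (2 * S + 1) (lift a) + Torus.proj (2 * S + 1) y := by
        funext i; simp [Torus.proj_apply]
      rw [hadd, hproj_lift, hyx, add_sub_cancel]
  -- count by the trace
  have hB0 : ∀ i : TorusSite 4 (2 * S + 1) × Fin 3, 0 ≤ ∑ a ∈ Bad, ω (i.1 - a) ^ 2 := fun i =>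
    Finset.sum_nonneg fun a _ => sq_nonneg _
  have hcount := ims_count hA E ((1 - η) * M2) (fun i => ∑ a ∈ Bad, ω (i.1 - a) ^ 2) hB0 hvec
  have hBsum : ∑ i : TorusSite 4 (2 * S + 1) × Fin 3, ∑ a ∈ Bad, ω (i.1 - a) ^ 2 =
      3 * M2 * Bad.card := by
    rw [Finset.sum_comm]
    have h3 : ∀ a ∈ Bad, ∑ i : TorusSite 4 (2 * S + 1) × Fin 3, ω (i.1 - a) ^ 2 = 3 * M2 := by
      intro a _
      rw [Fintype.sum_prod_type]
      simp only [Finset.sum_const, Finset.card_univ, Fintype.card_fin, nsmul_eq_mul, Nat.cast_ofNat]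
      rw [← Finset.mul_sum]
      congr 1
      exact Fintype.sum_equiv (Equiv.subRight a) _ _ fun x => rfl
    rw [Finset.sum_congr rfl h3, Finset.sum_const, nsmul_eq_mul]
    ring
  -- back to lattice centres
  have htrans : Bad.card ≤ ((box 4 S).filter cold).card := by
    refine Finset.card_le_card_of_injOn lift (fun a ha => ?_) (fun a _ b _ h => ?_)
    · rw [Finset.mem_coe, Finset.mem_filter] at ha ⊢
      refine ⟨?_, ha.2⟩
      rw [mem_box]
      intro i
      exact abs_le.mp (ims_abs_valMinAbs_le S (a i))
    · funext i
      exact ZMod.valMinAbs_inj.mp (congrFun h i)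
  -- conclusion
  have hfin : (1 - η) * M2 * ((Finset.univ.filter fun j => hA.eigenvalues j < E).card : ℝ) ≤
      3 * M2 * (((box 4 S).filter cold).card : ℝ) := by
    refine hcount.trans ?_
    rw [hBsum]
    have : (Bad.card : ℝ) ≤ (((box 4 S).filter cold).card : ℝ) := by exact_mod_cast htrans
    have hM20 : 0 ≤ M2 := hM2pos.le
    nlinarith
  have key : M2 * ((1 - η) * ((Finset.univ.filter fun j => hA.eigenvalues j < E).card : ℝ)) ≤
      M2 * (3 * (((box 4 S).filter cold).card : ℝ)) := by nlinarith
  exact le_of_mul_le_mul_left key hM2pos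

end

end Summit.QuantumFields.QCD.Cruxes.TipPricing.CovariantLaplacianFloor
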